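import Summits.CriticalPhenomena.PercolationContinuityZ3.Theorems.PercNearOneGluingNoHeavyLowerTailClubPsiHalves
import HarnessLib

/-!
# `NoHeavyLowerTail` (stmt-CriticalPhenomena-4575) — CLUB-Ψ(x): prim-lf-3's quantitative glued Question 9, from the JOINT atom

Support file (prover `prim-cplus-coupling`, gen 16; `--supports stmt-CriticalPhenomena-4575`); no definitions, named facts
or sorries.  Cell memo A5-COUPLING-gen16.md; companions `…ClubPsiJoint.lean` (the JOINT atom = `P1**-PLAIN-set` + BHK) and `…ClubPsiHalves.lean` (`ClubPsi.club_L_nonneg`).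

Notation (one bond percolation `μ`, observer SET `N`, designated port `x`, port `y`, witness `z`; `v ↔ N := ∃ n ∈ N, v ↔ n`,
`C_N = ⋃_{n∈N} C_n`): `J' = ({x↔N} ∪ {y↔N}) ∩ {z↮N}`, `E = {x↮N} ∩ {y↮N} ∩ {z↮N}`, `W2 = {y↔N} ∩ {x↮N} ∩ {z↮N}`,
`E2 = {y↮x} ∩ {y↮z}`, `Dzx = {z↮x}`, `Dyx = {y↮x}`, `Mz = {z↔N} ∩ {z↮x}`, `Jyz = {z↔y} ∩ {z↮x}`;
`b = μ(W2)`, `e₂ = μ(E2)`, `d = μ(Dzx)`, `c = μ(Mz)`, `j = μ(Jyz)`;  `K_x(F) = ∫_{J'}[F(C_N) − F(C_z)] + ∫_E[F(C_x) − F(C_z)]`.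
* `ClubPsi.club_L_nonneg` — from `ClubPsi.joint_nonneg` at `G = F` and `G = −k_F` (`k_F(S) = E F(C_x(η ∖ S̄))`, ONE antitone
  function of the conditioning cluster, be it `C_y` or `C_z`) and the tower / Harris-off-the-cluster steps
  (`Q7Psi.setIntegral_cluster_tower`, `Q7Psi.setIntegral_offEvent_le`):
  `e₂ d [∫_{W2}(F(C_y) − F(C_x)) + ∫_{Mz}(F(C_z) − F(C_x))] ≥ b d (E F(C_y) − E F(C_x)) + (e₂ c − b j)(E F(C_z) − E F(C_x))`.
* `ClubPsi.club_certificate` — `(e₂ d − b d − e₂ c + b j) · Dx(F) + b d · Dy(F) ≤ e₂ d · K_x(F)` for every monotone `F ≥ 0`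
  (pointwise `K_x − Dx ≥ ∫_{W2}(F(C_y) − F(C_x)) + ∫_{Mz}(F(C_z) − F(C_x))`, then `club_L_nonneg`).
* `ClubPsi.club_kappa_nonneg` — `0 ≤ (e₂ d − b d − e₂ c + b j) · μ(x ↮ y, x ↮ z)` (`club_L_nonneg` at `F = 1{y ∈ ·} ∨ 1{z ∈ ·}`).
* `ClubPsi.clubPsi` — **CLUB-Ψ(x)** (prim-lf-3 LF3-BETA-R §18g "MRΨ-glued", the last residual of the 2+m kernel; coupling seat
  gen15 §2 "CLUBΨ-x"): if `μ(x↮y, x↮z), μ(E2), μ(Dzx) > 0` (e.g. all weights `< 1`) then `Dx(F) ≥ 0 ∧ Dy(F) ≥ 0 ⟹ K_x(F) ≥ 0`,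
  i.e. `E F(C̃_z) ≤ ∫_{N↔{x,y,z}} F(C_N) + ∫_{N↮{x,y,z}} F(C_x)` in `G/N`.  `N = {o}`: the max-robust (GΨ₃) (`Q7Psi.gpsi_three_maxrobust`).
[cite: KozmaNitzan2024, §5.1 (pp. 31–32), Questions 7–9 (p. 36)] [cite: VandenbergHaggstromKahn2005, Thm 1.3 (p. 6), §1 pp. 7–8]
-/

namespace Summit.CriticalPhenomena.PercolationContinuityZ3.Theorems

open MeasureTheory Set Literature.Probability.LatticeModels Literature.Probability.Percolation
open scoped Classical
open KNPreFKG BHK2006 DecisionTree LonePortSum LonePortSumGeneral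

noncomputable section

namespace ClubPsi

open Q7Psi

universe u

variable {V : Type u} [Fintype V]

/-- **The CLUB-Ψ certificate.**  For monotone `F ≥ 0` on vertex sets (notation of the file header):
`(e₂ d − b d − e₂ c + b j) · (E F(C_x) − E F(C_z)) + b d · (E F(C_y) − E F(C_z)) ≤ e₂ d · K_x(F)`,
`K_x(F) = ∫_{J'} F(C_N) − ∫_{J'} F(C_z) + ∫_E F(C_x) − ∫_E F(C_z)`.  Proof: pointwise
`K_x − Dx ≥ ∫_{W2} (F(C_y) − F(C_x)) + ∫_{Mz} (F(C_z) − F(C_x))` (`C_x, C_y ⊆ C_N` on `{x↔N}`, `{y↔N}`; `C_x = C_z` on `{x↔z}`),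
then `club_L_nonneg`. (cell memo A5-COUPLING-gen16 §2) [cite: KozmaNitzan2024, §5.1 (pp. 31–32), Question 9 (p. 36)] -/
theorem club_certificate (w : Sym2 V → unitInterval) (x y z : V) (N : Set V) (hyx : y ≠ x) (hyz : y ≠ z)
    (F : Set V → ℝ) (hF : ∀ S T : Set V, S ⊆ T → F S ≤ F T) (hF0 : ∀ S, 0 ≤ F S) :
    ((prodBernoulli w).real ({ω : BondConfig V | ¬ (openGraph ω).Reachable y x} ∩ {ω | ¬ (openGraph ω).Reachable y z}) *
          (prodBernoulli w).real {ω : BondConfig V | ¬ (openGraph ω).Reachable z x} -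
        (prodBernoulli w).real ({ω : BondConfig V | ∃ n ∈ N, (openGraph ω).Reachable y n} ∩
            ({ω | ∀ n ∈ N, ¬ (openGraph ω).Reachable x n} ∩ {ω | ∀ n ∈ N, ¬ (openGraph ω).Reachable z n})) *
          (prodBernoulli w).real {ω : BondConfig V | ¬ (openGraph ω).Reachable z x} -
        (prodBernoulli w).real ({ω : BondConfig V | ¬ (openGraph ω).Reachable y x} ∩ {ω | ¬ (openGraph ω).Reachable y z}) *
          (prodBernoulli w).real ({ω : BondConfig V | ∃ n ∈ N, (openGraph ω).Reachable z n} ∩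
            {ω | ¬ (openGraph ω).Reachable z x}) +
        (prodBernoulli w).real ({ω : BondConfig V | ∃ n ∈ N, (openGraph ω).Reachable y n} ∩
            ({ω | ∀ n ∈ N, ¬ (openGraph ω).Reachable x n} ∩ {ω | ∀ n ∈ N, ¬ (openGraph ω).Reachable z n})) *
          (prodBernoulli w).real (openConn z y ∩ {ω | ¬ (openGraph ω).Reachable z x})) *
        ((∫ ω, F (openCluster ω x) ∂(prodBernoulli w)) - ∫ ω, F (openCluster ω z) ∂(prodBernoulli w)) +
      (prodBernoulli w).real ({ω : BondConfig V | ∃ n ∈ N, (openGraph ω).Reachable y n} ∩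
          ({ω | ∀ n ∈ N, ¬ (openGraph ω).Reachable x n} ∩ {ω | ∀ n ∈ N, ¬ (openGraph ω).Reachable z n})) *
        (prodBernoulli w).real {ω : BondConfig V | ¬ (openGraph ω).Reachable z x} *
        ((∫ ω, F (openCluster ω y) ∂(prodBernoulli w)) - ∫ ω, F (openCluster ω z) ∂(prodBernoulli w)) ≤
    (prodBernoulli w).real ({ω : BondConfig V | ¬ (openGraph ω).Reachable y x} ∩ {ω | ¬ (openGraph ω).Reachable y z}) *
      (prodBernoulli w).real {ω : BondConfig V | ¬ (openGraph ω).Reachable z x} *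
      ((∫ ω in ({ω : BondConfig V | ∃ n ∈ N, (openGraph ω).Reachable x n} ∪ {ω | ∃ n ∈ N, (openGraph ω).Reachable y n}) ∩
            {ω | ∀ n ∈ N, ¬ (openGraph ω).Reachable z n}, F (⋃ n ∈ N, openCluster ω n) ∂(prodBernoulli w)) -
        (∫ ω in ({ω : BondConfig V | ∃ n ∈ N, (openGraph ω).Reachable x n} ∪ {ω | ∃ n ∈ N, (openGraph ω).Reachable y n}) ∩
            {ω | ∀ n ∈ N, ¬ (openGraph ω).Reachable z n}, F (openCluster ω z) ∂(prodBernoulli w)) +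
        (∫ ω in {ω : BondConfig V | ∀ n ∈ N, ¬ (openGraph ω).Reachable x n} ∩
            ({ω | ∀ n ∈ N, ¬ (openGraph ω).Reachable y n} ∩ {ω | ∀ n ∈ N, ¬ (openGraph ω).Reachable z n}),
            F (openCluster ω x) ∂(prodBernoulli w)) -
        ∫ ω in {ω : BondConfig V | ∀ n ∈ N, ¬ (openGraph ω).Reachable x n} ∩
            ({ω | ∀ n ∈ N, ¬ (openGraph ω).Reachable y n} ∩ {ω | ∀ n ∈ N, ¬ (openGraph ω).Reachable z n}),
            F (openCluster ω z) ∂(prodBernoulli w)) := by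
  classical
  set μ := prodBernoulli w with hμ
  set wt : Set (Sym2 V) → ℝ := weight (fun e => (w e : ℝ)) with hwt
  have hwt0 : ∀ ω, 0 ≤ wt ω := fun ω => weight_nonneg (fun e => (w e).2.1) (fun e => (w e).2.2) ω
  set fx : BondConfig V → ℝ := fun ω => F (openCluster ω x) with hfx
  set fy : BondConfig V → ℝ := fun ω => F (openCluster ω y) with hfy
  set fz : BondConfig V → ℝ := fun ω => F (openCluster ω z) with hfz
  set fN : BondConfig V → ℝ := fun ω => F (⋃ n ∈ N, openCluster ω n) with hfN
  set Ox : Set (BondConfig V) := {ω : BondConfig V | ∃ n ∈ N, (openGraph ω).Reachable x n} with hOx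
  set Oy : Set (BondConfig V) := {ω : BondConfig V | ∃ n ∈ N, (openGraph ω).Reachable y n} with hOy
  set Oz : Set (BondConfig V) := {ω : BondConfig V | ∃ n ∈ N, (openGraph ω).Reachable z n} with hOz
  set Ex : Set (BondConfig V) := {ω | ∀ n ∈ N, ¬ (openGraph ω).Reachable x n} with hEx
  set Ey : Set (BondConfig V) := {ω | ∀ n ∈ N, ¬ (openGraph ω).Reachable y n} with hEy
  set Ez : Set (BondConfig V) := {ω | ∀ n ∈ N, ¬ (openGraph ω).Reachable z n} with hEz
  set W2 : Set (BondConfig V) := Oy ∩ (Ex ∩ Ez) with hW2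
  set Dyx : Set (BondConfig V) := {ω : BondConfig V | ¬ (openGraph ω).Reachable y x} with hDyx
  set Dyz : Set (BondConfig V) := {ω : BondConfig V | ¬ (openGraph ω).Reachable y z} with hDyz
  set Dzx : Set (BondConfig V) := {ω : BondConfig V | ¬ (openGraph ω).Reachable z x} with hDzx
  set E2 : Set (BondConfig V) := Dyx ∩ Dyz with hE2
  set Mz : Set (BondConfig V) := Oz ∩ Dzx with hMz
  set Jyz : Set (BondConfig V) := openConn z y ∩ Dzx with hJyz
  set J' : Set (BondConfig V) := (Ox ∪ Oy) ∩ Ez with hJ'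
  set E : Set (BondConfig V) := Ex ∩ (Ey ∩ Ez) with hE
  show (μ.real E2 * μ.real Dzx - μ.real W2 * μ.real Dzx - μ.real E2 * μ.real Mz + μ.real W2 * μ.real Jyz) *
        ((∫ ω, fx ω ∂μ) - ∫ ω, fz ω ∂μ) + μ.real W2 * μ.real Dzx * ((∫ ω, fy ω ∂μ) - ∫ ω, fz ω ∂μ) ≤
      μ.real E2 * μ.real Dzx * ((∫ ω in J', fN ω ∂μ) - (∫ ω in J', fz ω ∂μ) + (∫ ω in E, fx ω ∂μ) - ∫ ω in E, fz ω ∂μ)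
  have hL := club_L_nonneg w x y z N hyx hyz F hF hF0
  change μ.real W2 * μ.real Dzx * ((∫ ω, fy ω ∂μ) - ∫ ω, fx ω ∂μ) +
      (μ.real E2 * μ.real Mz - μ.real W2 * μ.real Jyz) * ((∫ ω, fz ω ∂μ) - ∫ ω, fx ω ∂μ) ≤
    μ.real E2 * μ.real Dzx * ((∫ ω in W2, fy ω ∂μ) - (∫ ω in W2, fx ω ∂μ) + (∫ ω in Mz, fz ω ∂μ) - ∫ ω in Mz, fx ω ∂μ) at hL
  -- the pointwise bound `K_x − Dx ≥ ∫_{W2}(fy − fx) + ∫_{Mz}(fz − fx)`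
  have hxN : ∀ ω ∈ Ox, fx ω ≤ fN ω := fun ω hω => hF _ _ (openCluster_subset_iUnion_of_reach hω)
  have hyN : ∀ ω ∈ Oy, fy ω ≤ fN ω := fun ω hω => hF _ _ (openCluster_subset_iUnion_of_reach hω)
  have pP : ∀ ω, wt ω * (fy ω * ind W2 ω) - wt ω * (fx ω * ind W2 ω) + wt ω * (fz ω * ind Mz ω) - wt ω * (fx ω * ind Mz ω) ≤
      wt ω * (fN ω * ind J' ω) - wt ω * (fz ω * ind J' ω) + wt ω * (fx ω * ind E ω) - wt ω * (fz ω * ind E ω) -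
        (wt ω * fx ω - wt ω * fz ω) := by
    intro ω
    have key : fy ω * ind W2 ω - fx ω * ind W2 ω + fz ω * ind Mz ω - fx ω * ind Mz ω ≤
        fN ω * ind J' ω - fz ω * ind J' ω + fx ω * ind E ω - fz ω * ind E ω - (fx ω - fz ω) := by
      by_cases hz : ω ∈ Oz
      · have hEz' : ω ∉ Ez := fun h => by obtain ⟨n, hn, hr⟩ := hz; exact h n hn hr
        rw [ind_of_not_mem (show ω ∉ W2 from fun h => hEz' h.2.2), ind_of_not_mem (show ω ∉ J' from fun h => hEz' h.2),
          ind_of_not_mem (show ω ∉ E from fun h => hEz' h.2.2)]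
        by_cases hzx : ω ∈ Dzx
        · rw [ind_of_mem (show ω ∈ Mz from ⟨hz, hzx⟩)]; linarith
        · have hzxr : (openGraph ω).Reachable z x := not_not.1 hzx
          rw [ind_of_not_mem (show ω ∉ Mz from fun h => hzx h.2)]
          have hcl : fz ω = fx ω := by simp only [hfx, hfz, openCluster_eq_of_reachable hzxr]
          linarith [hcl]
      · have hEz' : ω ∈ Ez := fun n hn hr => hz ⟨n, hn, hr⟩
        rw [ind_of_not_mem (show ω ∉ Mz from fun h => hz h.1)]
        by_cases hx : ω ∈ Ox
        · have hEx' : ω ∉ Ex := fun h => by obtain ⟨n, hn, hr⟩ := hx; exact h n hn hr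
          rw [ind_of_not_mem (show ω ∉ W2 from fun h => hEx' h.2.1), ind_of_mem (show ω ∈ J' from ⟨Or.inl hx, hEz'⟩),
            ind_of_not_mem (show ω ∉ E from fun h => hEx' h.1)]
          have e1 := hxN ω hx
          linarith
        · have hEx' : ω ∈ Ex := fun n hn hr => hx ⟨n, hn, hr⟩
          by_cases hy : ω ∈ Oy
          · have hEy' : ω ∉ Ey := fun h => by obtain ⟨n, hn, hr⟩ := hy; exact h n hn hr
            rw [ind_of_mem (show ω ∈ W2 from ⟨hy, hEx', hEz'⟩), ind_of_mem (show ω ∈ J' from ⟨Or.inr hy, hEz'⟩),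
              ind_of_not_mem (show ω ∉ E from fun h => hEy' h.2.1)]
            have e1 := hyN ω hy
            linarith
          · have hEy' : ω ∈ Ey := fun n hn hr => hy ⟨n, hn, hr⟩
            rw [ind_of_not_mem (show ω ∉ W2 from fun h => hy h.1), ind_of_not_mem (show ω ∉ J' from fun h => h.1.elim hx hy),
              ind_of_mem (show ω ∈ E from ⟨hEx', hEy', hEz'⟩)]
            linarith
    have := mul_le_mul_of_nonneg_left key (hwt0 ω)
    nlinarith [this]
  have sP := Finset.sum_le_sum fun ω (_ : ω ∈ Finset.univ) => pP ω
  simp only [Finset.sum_sub_distrib, Finset.sum_add_distrib] at sP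
  rw [integral_prodBernoulli_eq_sum, integral_prodBernoulli_eq_sum, integral_prodBernoulli_eq_sum,
    setIntegral_eq_sum w, setIntegral_eq_sum w, setIntegral_eq_sum w, setIntegral_eq_sum w] at hL
  rw [integral_prodBernoulli_eq_sum, integral_prodBernoulli_eq_sum, integral_prodBernoulli_eq_sum,
    setIntegral_eq_sum w, setIntegral_eq_sum w, setIntegral_eq_sum w, setIntegral_eq_sum w]
  have hc0 : 0 ≤ μ.real E2 * μ.real Dzx := mul_nonneg measureReal_nonneg measureReal_nonneg
  have e2 := mul_le_mul_of_nonneg_left sP hc0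
  nlinarith [hL, e2]

/-- **The `Dx`-multiplier is nonnegative**: `0 ≤ (e₂ d − b d − e₂ c + b j) · μ(x ↮ y, x ↮ z)` — `club_L_nonneg` at the
monotone test function `F = 1{y ∈ ·} ∨ 1{z ∈ ·}`, for which `F(C_y) = F(C_z) = 1`, `F(C_x) = 1{x↔y ∨ x↔z}`, and the sets
`W2 ∖ {x↔y ∨ x↔z}`, `Mz ∖ {x↔y ∨ x↔z}` are disjoint parts of `{x ↮ y, z}`. (cell memo A5-COUPLING-gen16 §2) [folklore] -/
theorem club_kappa_nonneg (w : Sym2 V → unitInterval) (x y z : V) (N : Set V) (hyx : y ≠ x) (hyz : y ≠ z) :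
    0 ≤ ((prodBernoulli w).real ({ω : BondConfig V | ¬ (openGraph ω).Reachable y x} ∩ {ω | ¬ (openGraph ω).Reachable y z}) *
          (prodBernoulli w).real {ω : BondConfig V | ¬ (openGraph ω).Reachable z x} -
        (prodBernoulli w).real ({ω : BondConfig V | ∃ n ∈ N, (openGraph ω).Reachable y n} ∩
            ({ω | ∀ n ∈ N, ¬ (openGraph ω).Reachable x n} ∩ {ω | ∀ n ∈ N, ¬ (openGraph ω).Reachable z n})) *
          (prodBernoulli w).real {ω : BondConfig V | ¬ (openGraph ω).Reachable z x} -
        (prodBernoulli w).real ({ω : BondConfig V | ¬ (openGraph ω).Reachable y x} ∩ {ω | ¬ (openGraph ω).Reachable y z}) *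
          (prodBernoulli w).real ({ω : BondConfig V | ∃ n ∈ N, (openGraph ω).Reachable z n} ∩
            {ω | ¬ (openGraph ω).Reachable z x}) +
        (prodBernoulli w).real ({ω : BondConfig V | ∃ n ∈ N, (openGraph ω).Reachable y n} ∩
            ({ω | ∀ n ∈ N, ¬ (openGraph ω).Reachable x n} ∩ {ω | ∀ n ∈ N, ¬ (openGraph ω).Reachable z n})) *
          (prodBernoulli w).real (openConn z y ∩ {ω | ¬ (openGraph ω).Reachable z x})) *
      (prodBernoulli w).real ({ω : BondConfig V | ¬ (openGraph ω).Reachable x y} ∩ {ω | ¬ (openGraph ω).Reachable x z}) := by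
  classical
  set μ := prodBernoulli w with hμ
  set wt : Set (Sym2 V) → ℝ := weight (fun e => (w e : ℝ)) with hwt
  have hwt0 : ∀ ω, 0 ≤ wt ω := fun ω => weight_nonneg (fun e => (w e).2.1) (fun e => (w e).2.2) ω
  have hm : ∑ ω, wt ω = 1 := by
    have h1 := integral_prodBernoulli_eq_sum w fun _ => (1 : ℝ)
    simp only [integral_const, probReal_univ, smul_eq_mul, mul_one] at h1
    exact h1.symm
  set Oy : Set (BondConfig V) := {ω : BondConfig V | ∃ n ∈ N, (openGraph ω).Reachable y n} with hOy
  set Oz : Set (BondConfig V) := {ω : BondConfig V | ∃ n ∈ N, (openGraph ω).Reachable z n} with hOz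
  set Ex : Set (BondConfig V) := {ω | ∀ n ∈ N, ¬ (openGraph ω).Reachable x n} with hEx
  set Ez : Set (BondConfig V) := {ω | ∀ n ∈ N, ¬ (openGraph ω).Reachable z n} with hEz
  set W2 : Set (BondConfig V) := Oy ∩ (Ex ∩ Ez) with hW2
  set Dyx : Set (BondConfig V) := {ω : BondConfig V | ¬ (openGraph ω).Reachable y x} with hDyx
  set Dyz : Set (BondConfig V) := {ω : BondConfig V | ¬ (openGraph ω).Reachable y z} with hDyz
  set Dzx : Set (BondConfig V) := {ω : BondConfig V | ¬ (openGraph ω).Reachable z x} with hDzx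
  set E2 : Set (BondConfig V) := Dyx ∩ Dyz with hE2
  set Mz : Set (BondConfig V) := Oz ∩ Dzx with hMz
  set Jyz : Set (BondConfig V) := openConn z y ∩ Dzx with hJyz
  set U : Set (BondConfig V) := {ω : BondConfig V | ¬ (openGraph ω).Reachable x y} ∩ {ω | ¬ (openGraph ω).Reachable x z}
    with hU
  show 0 ≤ (μ.real E2 * μ.real Dzx - μ.real W2 * μ.real Dzx - μ.real E2 * μ.real Mz + μ.real W2 * μ.real Jyz) * μ.real U
  -- the test function
  set u0 : Set V → ℝ := fun S => if y ∈ S ∨ z ∈ S then 1 else 0 with hu0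
  have hu0m : ∀ S T : Set V, S ⊆ T → u0 S ≤ u0 T := by
    intro S T hST
    simp only [hu0]
    by_cases h : y ∈ S ∨ z ∈ S
    · rw [if_pos h, if_pos (h.imp (fun h' => hST h') (fun h' => hST h'))]
    · rw [if_neg h]; split_ifs <;> norm_num
  have hu00 : ∀ S, 0 ≤ u0 S := fun S => by simp only [hu0]; split_ifs <;> norm_num
  have hL := club_L_nonneg w x y z N hyx hyz u0 hu0m hu00
  change μ.real W2 * μ.real Dzx * ((∫ ω, u0 (openCluster ω y) ∂μ) - ∫ ω, u0 (openCluster ω x) ∂μ) +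
      (μ.real E2 * μ.real Mz - μ.real W2 * μ.real Jyz) * ((∫ ω, u0 (openCluster ω z) ∂μ) - ∫ ω, u0 (openCluster ω x) ∂μ) ≤
    μ.real E2 * μ.real Dzx * ((∫ ω in W2, u0 (openCluster ω y) ∂μ) - (∫ ω in W2, u0 (openCluster ω x) ∂μ) +
      (∫ ω in Mz, u0 (openCluster ω z) ∂μ) - ∫ ω in Mz, u0 (openCluster ω x) ∂μ) at hL
  -- values of the test function on the three clusters
  have vy : ∀ ω : BondConfig V, u0 (openCluster ω y) = 1 := fun ω => by
    have h : y ∈ openCluster ω y ∨ z ∈ openCluster ω y := Or.inl (SimpleGraph.Reachable.refl y)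
    simp only [hu0]; rw [if_pos h]
  have vz : ∀ ω : BondConfig V, u0 (openCluster ω z) = 1 := fun ω => by
    have h : y ∈ openCluster ω z ∨ z ∈ openCluster ω z := Or.inr (SimpleGraph.Reachable.refl z)
    simp only [hu0]; rw [if_pos h]
  have vx : ∀ ω : BondConfig V, u0 (openCluster ω x) = 1 - ind U ω := fun ω => by
    simp only [hu0]
    by_cases h : ω ∈ U
    · rw [ind_of_mem h, if_neg (fun h' => h'.elim h.1 h.2)]; norm_num
    · rw [ind_of_not_mem h, sub_zero, if_pos]
      by_contra hcon
      exact h ⟨fun h1 => hcon (Or.inl h1), fun h2 => hcon (Or.inr h2)⟩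
  simp only [vy, vz, vx] at hL
  rw [integral_prodBernoulli_eq_sum, integral_prodBernoulli_eq_sum, setIntegral_eq_sum w, setIntegral_eq_sum w,
    setIntegral_eq_sum w, setIntegral_eq_sum w] at hL
  rw [measureReal_eq_sum w U]
  -- pointwise: `1_{W2}(1 − (1 − 1_U)) + 1_{Mz}(1 − (1 − 1_U)) ≤ 1_U` (the two sets are disjoint)
  have pP : ∀ ω, wt ω * (1 * ind W2 ω) - wt ω * ((1 - ind U ω) * ind W2 ω) + wt ω * (1 * ind Mz ω) -
      wt ω * ((1 - ind U ω) * ind Mz ω) ≤ wt ω * ind U ω := by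
    intro ω
    have hdisj : ind W2 ω + ind Mz ω ≤ 1 := by
      by_cases hz : ω ∈ Oz
      · have : ω ∉ W2 := fun h => by obtain ⟨n, hn, hr⟩ := hz; exact h.2.2 n hn hr
        rw [ind_of_not_mem this, zero_add]; exact ind_le_one _ _
      · rw [ind_of_not_mem (show ω ∉ Mz from fun h => hz h.1), add_zero]; exact ind_le_one _ _
    have h1 : 0 ≤ ind U ω := ind_nonneg _ _
    have h2 : 0 ≤ ind W2 ω := ind_nonneg _ _
    have h3 : 0 ≤ ind Mz ω := ind_nonneg _ _
    have key : 1 * ind W2 ω - (1 - ind U ω) * ind W2 ω + 1 * ind Mz ω - (1 - ind U ω) * ind Mz ω ≤ ind U ω := by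
      nlinarith
    have := mul_le_mul_of_nonneg_left key (hwt0 ω)
    nlinarith [this]
  have sP := Finset.sum_le_sum fun ω (_ : ω ∈ Finset.univ) => pP ω
  simp only [Finset.sum_sub_distrib, Finset.sum_add_distrib] at sP
  have s1 : ∑ ω, wt ω * (1 : ℝ) = 1 := by simp only [mul_one]; exact hm
  have s2 : ∑ ω, wt ω * (1 - ind U ω) = 1 - ∑ ω, wt ω * ind U ω := by
    simp only [mul_sub, mul_one, Finset.sum_sub_distrib, hm]
  rw [s1, s2] at hL
  have hc0 : 0 ≤ μ.real E2 * μ.real Dzx := mul_nonneg measureReal_nonneg measureReal_nonneg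
  have e2 := mul_le_mul_of_nonneg_left sP hc0
  nlinarith [hL, e2]

/-- **CLUB-Ψ(x)** (prim-lf-3's quantitative glued Question 9 at the Ψ level, LF3-BETA-R §18g; the coupling seat's CLUBΨ-x, gen15
§2).  In the notation of the file header, under the non-degeneracy `μ(x↮y, x↮z), μ(y↮x, y↮z), μ(z↮x) > 0` (all hold when every
weight is `< 1`): for every monotone `F ≥ 0` on vertex sets with `E F(C_z) ≤ E F(C_x)` and `E F(C_z) ≤ E F(C_y)` (designation in the
UNGLUED graph),  `∫_{J'} F(C_z) + ∫_E F(C_z) ≤ ∫_{J'} F(C_N) + ∫_E F(C_x)`, i.e. `E F(C̃_z) ≤ E F(Ĉ_x)` in `G/N`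
(`C̃_z` the glued cluster of `z`, `Ĉ_x = C_N` on `{N ↔ x,y,z}`, `= C_x` elsewhere).  From `club_certificate` and `club_kappa_nonneg`;
the atom is `P1**-PLAIN-set` (`ClubPsi.setPlainMarkerDominance_cov`).  `N = {o}`: the max-robust (GΨ₃) `Q7Psi.gpsi_three_maxrobust`.
[cite: KozmaNitzan2024, §5.1 (pp. 31–32), Questions 7–9 (p. 36)] [cite: VandenbergHaggstromKahn2005, Thms 1.3–1.5 (pp. 6–7), §2.1] -/
theorem clubPsi (w : Sym2 V → unitInterval) (x y z : V) (N : Set V) (hyx : y ≠ x) (hyz : y ≠ z)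
    (hEx : 0 < (prodBernoulli w).real ({ω : BondConfig V | ¬ (openGraph ω).Reachable x y} ∩ {ω | ¬ (openGraph ω).Reachable x z}))
    (hE2 : 0 < (prodBernoulli w).real ({ω : BondConfig V | ¬ (openGraph ω).Reachable y x} ∩ {ω | ¬ (openGraph ω).Reachable y z}))
    (hDzx : 0 < (prodBernoulli w).real {ω : BondConfig V | ¬ (openGraph ω).Reachable z x})
    (F : Set V → ℝ) (hF : ∀ S T : Set V, S ⊆ T → F S ≤ F T) (hF0 : ∀ S, 0 ≤ F S)
    (hDx : ∫ ω, F (openCluster ω z) ∂(prodBernoulli w) ≤ ∫ ω, F (openCluster ω x) ∂(prodBernoulli w))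
    (hDy : ∫ ω, F (openCluster ω z) ∂(prodBernoulli w) ≤ ∫ ω, F (openCluster ω y) ∂(prodBernoulli w)) :
    (∫ ω in ({ω : BondConfig V | ∃ n ∈ N, (openGraph ω).Reachable x n} ∪ {ω | ∃ n ∈ N, (openGraph ω).Reachable y n}) ∩
          {ω | ∀ n ∈ N, ¬ (openGraph ω).Reachable z n}, F (openCluster ω z) ∂(prodBernoulli w)) +
      ∫ ω in {ω : BondConfig V | ∀ n ∈ N, ¬ (openGraph ω).Reachable x n} ∩
          ({ω | ∀ n ∈ N, ¬ (openGraph ω).Reachable y n} ∩ {ω | ∀ n ∈ N, ¬ (openGraph ω).Reachable z n}),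
          F (openCluster ω z) ∂(prodBernoulli w) ≤
    (∫ ω in ({ω : BondConfig V | ∃ n ∈ N, (openGraph ω).Reachable x n} ∪ {ω | ∃ n ∈ N, (openGraph ω).Reachable y n}) ∩
          {ω | ∀ n ∈ N, ¬ (openGraph ω).Reachable z n}, F (⋃ n ∈ N, openCluster ω n) ∂(prodBernoulli w)) +
      ∫ ω in {ω : BondConfig V | ∀ n ∈ N, ¬ (openGraph ω).Reachable x n} ∩
          ({ω | ∀ n ∈ N, ¬ (openGraph ω).Reachable y n} ∩ {ω | ∀ n ∈ N, ¬ (openGraph ω).Reachable z n}),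
          F (openCluster ω x) ∂(prodBernoulli w) := by
  have hC := club_certificate w x y z N hyx hyz F hF hF0
  have hK := club_kappa_nonneg w x y z N hyx hyz
  set κ : ℝ := (prodBernoulli w).real ({ω : BondConfig V | ¬ (openGraph ω).Reachable y x} ∩ {ω | ¬ (openGraph ω).Reachable y z}) *
          (prodBernoulli w).real {ω : BondConfig V | ¬ (openGraph ω).Reachable z x} -
        (prodBernoulli w).real ({ω : BondConfig V | ∃ n ∈ N, (openGraph ω).Reachable y n} ∩
            ({ω | ∀ n ∈ N, ¬ (openGraph ω).Reachable x n} ∩ {ω | ∀ n ∈ N, ¬ (openGraph ω).Reachable z n})) *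
          (prodBernoulli w).real {ω : BondConfig V | ¬ (openGraph ω).Reachable z x} -
        (prodBernoulli w).real ({ω : BondConfig V | ¬ (openGraph ω).Reachable y x} ∩ {ω | ¬ (openGraph ω).Reachable y z}) *
          (prodBernoulli w).real ({ω : BondConfig V | ∃ n ∈ N, (openGraph ω).Reachable z n} ∩
            {ω | ¬ (openGraph ω).Reachable z x}) +
        (prodBernoulli w).real ({ω : BondConfig V | ∃ n ∈ N, (openGraph ω).Reachable y n} ∩
            ({ω | ∀ n ∈ N, ¬ (openGraph ω).Reachable x n} ∩ {ω | ∀ n ∈ N, ¬ (openGraph ω).Reachable z n})) *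
          (prodBernoulli w).real (openConn z y ∩ {ω | ¬ (openGraph ω).Reachable z x}) with hκ
  have hκ0 : 0 ≤ κ := le_of_mul_le_mul_right (by rw [zero_mul]; exact hK) hEx
  have hb0 : 0 ≤ (prodBernoulli w).real ({ω : BondConfig V | ∃ n ∈ N, (openGraph ω).Reachable y n} ∩
      ({ω | ∀ n ∈ N, ¬ (openGraph ω).Reachable x n} ∩ {ω | ∀ n ∈ N, ¬ (openGraph ω).Reachable z n})) *
      (prodBernoulli w).real {ω : BondConfig V | ¬ (openGraph ω).Reachable z x} := mul_nonneg measureReal_nonneg measureReal_nonneg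
  have hpos : 0 < (prodBernoulli w).real ({ω : BondConfig V | ¬ (openGraph ω).Reachable y x} ∩
      {ω | ¬ (openGraph ω).Reachable y z}) * (prodBernoulli w).real {ω : BondConfig V | ¬ (openGraph ω).Reachable z x} :=
    mul_pos hE2 hDzx
  have h1 : 0 ≤ κ * ((∫ ω, F (openCluster ω x) ∂(prodBernoulli w)) - ∫ ω, F (openCluster ω z) ∂(prodBernoulli w)) :=
    mul_nonneg hκ0 (by linarith)
  have h2 : 0 ≤ (prodBernoulli w).real ({ω : BondConfig V | ∃ n ∈ N, (openGraph ω).Reachable y n} ∩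
      ({ω | ∀ n ∈ N, ¬ (openGraph ω).Reachable x n} ∩ {ω | ∀ n ∈ N, ¬ (openGraph ω).Reachable z n})) *
      (prodBernoulli w).real {ω : BondConfig V | ¬ (openGraph ω).Reachable z x} *
      ((∫ ω, F (openCluster ω y) ∂(prodBernoulli w)) - ∫ ω, F (openCluster ω z) ∂(prodBernoulli w)) :=
    mul_nonneg hb0 (by linarith)
  have h3 := le_trans (add_nonneg h1 h2) hC
  have h4 := (mul_nonneg_iff_of_pos_left hpos).1 h3
  linarith

end ClubPsi

end

end Summit.CriticalPhenomena.PercolationContinuityZ3.Theorems
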